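import Summits.RiemannHypothesis.RiemannHypothesis.Theorems.PfPersistenceTransportTwin
import Summits.RiemannHypothesis.RiemannHypothesis.Theorems.PfPersistenceLookAhead
import HarnessLib

/-!
# PF persistence — G1 clause (1) under THREE typings: Tychonoff-open (= W1's class), window-wise open (of record), and
# the k-WINDOW COUPLED (sliding) open presentation (pub-rhpf barrier-typer gen 7; RULING A130 (3) executed as facts)

**HONEST FRAMING. Long-odds MECHANISM SEARCH; no RH claims.** Labels PROVED / TYPED / DATA as in
`PfPersistenceAdmissibleClass.lean`; RH-free bookkeeping about the SHAPE of criteria, except §6 (a CONDITIONAL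
"`ζ` in the class ⇒ RH", RH-strength label E1, credits nothing). CONTEXT: `PfPersistenceTransportTwin` (94721571e2b4)
PROVED a two-window transport law is not WINDOW-WISE, hence has no `InG1cont`/`InG1contU`/`InG1int` certificate
(A130 A1: "impossible by shape under G1 AS TYPED", clause (1) = product presentation); A130 (3) left to adj-3 whether
clause (1) should read "open in the product topology" and whether a multi-window presentation is a new row. Facts:
§1 `ε₁` is CONTINUOUS in the matrix topology (`continuous_bottomRayleigh`, via the entrywise `ℓ¹`-Lipschitz law).
§2 TYCHONOFF READING = W1's class: an open `S ∋ ζ` contains a finitely determined `S' ∋ ζ`, so separates `ζ` from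
the negatives on no `D ⊇ arithDialSpace` (`not_separates_of_isOpen_arith`); `P⁺` is not Tychonoff-open.
§3 COUPLED PRESENTATION `IsCoupledOpen k h hh S`: `S = {d | ∀ win, (d(win + jh))_{j<k} ∈ P win}`, `P win` OPEN — the
typed home of stride / look-ahead coupled readers. Window-wise open ⇒ coupled-open (`k ≥ 1`); coupled-open `∋ ζ` ⇒
STABLE ALONG every window-wise convergent dial (patch `ζ` at one window: finitely many open anchor conditions), so
DIAL-STABLE — clause (3) is discharged as in the product case. Schema `InG1coupled := IsCoupledOpen ∧
NonlocalAtEveryHeight ∧ DialStable`, certificate `inG1coupled_of`, and `InG1cont ⊆ InG1coupled k h`.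
§4 BOUNDED ANCHOR SETS are inside W1 for every coupled reader (`not_separates_coupledClassOn_below`), generalising
`not_separates_lookAheadClassOn` (b89473c9a330) and `not_separates_transportTwin_of_subset_below` (94721571e2b4).
§5 STRICT STRIDE TWIN `{d | ∀ (a,N), c·Φ(a)·ε₁(d(a,N)) < Φ(a+h)·ε₁(d(a+h,N))}`: a FULL `InG1coupled 2 h` certificate
(`0 < h`, `0 < c`, `c·Φ(a) < Φ(a+h)`, `Φ > 0`) AND not window-wise (exchange property fails), so in none of
G1-cont/contU/int: the coupled stratum is STRICTLY WIDER than the product stratum (`strideTwinStrict_placement`).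
§6 STRENGTH (CONDITIONAL, E1): for any stride `0 < h < log 3 / 2`, `ζ ∈ strideTwinStrict h hh c Φ ⇒ RH` — seeded on
`(0, h]` by the proved rung `weilGroundEnergy_pos_of_lt_log_three_half'`, chained by induction on strides.
NOT SAID: anything about `ζ`'s membership in a coupled class (DATA / E1); the all-pairs `transportTwin` is not a
sliding `k`-window class and its dial-stability (per-window uniform slack) is not decided here; W2 is untouched.
-/

set_option linter.dupNamespace false  -- the mandated namespace repeats `RiemannHypothesis`

noncomputable section

open Real Set Matrix Filter Topology
open Literature.NumberTheory.LFunctions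
open Summit.RiemannHypothesis.RiemannHypothesis.Theorems.SpectralTraceWindowStep

namespace Summit.RiemannHypothesis.RiemannHypothesis.Theorems.PfPersistence

/-! ## §1 `ε₁` is continuous in the matrix topology -/

/-- PROVED: `|vᵀEv| ≤ (Σ_{ij} |E_ij|) · vᵀv`. [folklore] -/
theorem abs_form_le_sum_abs {n : ℕ} (E : Matrix (Fin n) (Fin n) ℝ) (v : Fin n → ℝ) :
    |v ⬝ᵥ (E *ᵥ v)| ≤ (∑ i, ∑ j, |E i j|) * (v ⬝ᵥ v) := by
  have hvv : ∀ i, v i * v i ≤ v ⬝ᵥ v := fun i =>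
    Finset.single_le_sum (f := fun l => v l * v l) (fun l _ => mul_self_nonneg (v l)) (Finset.mem_univ i)
  have hij : ∀ i j, |v i| * |v j| ≤ v ⬝ᵥ v := fun i j => by
    nlinarith [hvv i, hvv j, sq_nonneg (|v i| - |v j|), abs_mul_abs_self (v i), abs_mul_abs_self (v j),
      abs_nonneg (v i), abs_nonneg (v j)]
  calc |v ⬝ᵥ (E *ᵥ v)| = |∑ i, ∑ j, v i * (E i j * v j)| := by simp only [dotProduct, mulVec, Finset.mul_sum]
    _ ≤ ∑ i, |∑ j, v i * (E i j * v j)| := Finset.abs_sum_le_sum_abs _ _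
    _ ≤ ∑ i, ∑ j, |v i * (E i j * v j)| := Finset.sum_le_sum fun i _ => Finset.abs_sum_le_sum_abs _ _
    _ = ∑ i, ∑ j, |E i j| * (|v i| * |v j|) :=
        Finset.sum_congr rfl fun i _ => Finset.sum_congr rfl fun j _ => by rw [abs_mul, abs_mul]; ring
    _ ≤ ∑ i, ∑ j, |E i j| * (v ⬝ᵥ v) :=
        Finset.sum_le_sum fun i _ => Finset.sum_le_sum fun j _ => mul_le_mul_of_nonneg_left (hij i j) (abs_nonneg _)
    _ = (∑ i, ∑ j, |E i j|) * (v ⬝ᵥ v) := by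
        rw [Finset.sum_mul]; exact Finset.sum_congr rfl fun i _ => (Finset.sum_mul _ _ _).symm

/-- **PROVED — `ε₁` is entrywise `ℓ¹`-LIPSCHITZ:** `|ε₁(M) − ε₁(M')| ≤ Σ_{ij} |M_ij − M'_ij|`. [folklore] -/
theorem abs_bottomRayleigh_sub_le_sum {n : ℕ} (M M' : Matrix (Fin (n + 1)) (Fin (n + 1)) ℝ) :
    |bottomRayleigh M - bottomRayleigh M'| ≤ ∑ i, ∑ j, |M i j - M' i j| :=
  abs_bottomRayleigh_sub_le fun v => by simpa only [Matrix.sub_apply] using abs_form_le_sum_abs (M - M') v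

/-- **PROVED — `ε₁` IS CONTINUOUS in the matrix (entrywise / product) topology.** [folklore] -/
theorem continuous_bottomRayleigh (n : ℕ) :
    Continuous (bottomRayleigh : Matrix (Fin (n + 1)) (Fin (n + 1)) ℝ → ℝ) := by
  refine continuous_iff_continuousAt.2 fun M₀ => ?_
  have hg : Continuous fun M : Matrix (Fin (n + 1)) (Fin (n + 1)) ℝ => ∑ i, ∑ j, |M i j - M₀ i j| :=
    continuous_finsetSum _ fun i _ => continuous_finsetSum _ fun j _ =>
      ((continuous_id.matrix_elem i j).sub continuous_const).abs
  have hg0 : Tendsto (fun M : Matrix (Fin (n + 1)) (Fin (n + 1)) ℝ => ∑ i, ∑ j, |M i j - M₀ i j|) (𝓝 M₀)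
      (𝓝 0) := by simpa using hg.tendsto M₀
  rw [ContinuousAt, tendsto_iff_dist_tendsto_zero]
  exact squeeze_zero (fun _ => dist_nonneg)
    (fun M => (Real.dist_eq _ _).le.trans (abs_bottomRayleigh_sub_le_sum M M₀)) hg0

/-! ## §2 The Tychonoff reading of clause (1) is the locality barrier's class -/

/-- PROVED: a Tychonoff-open set `∋ ζ` contains a FINITELY DETERMINED set `∋ ζ` (a basic box is finite). [folklore] -/
theorem exists_finitelyDetermined_of_isOpen {S : Set Datum} (hS : IsOpen S) (hζ : zetaDatum ∈ S) :
    ∃ S' : Set Datum, S' ⊆ S ∧ zetaDatum ∈ S' ∧ FinitelyDetermined S' := by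
  obtain ⟨I, u, hu, hIS⟩ := isOpen_pi_iff.1 hS zetaDatum hζ
  refine ⟨(I : Set Window).pi u, hIS, fun win hwin => (hu win hwin).2, I, fun d d' hdd' => ?_⟩
  simp only [Set.mem_pi, Finset.mem_coe]
  exact forall₂_congr fun win hwin => by rw [hdd' win hwin]

/-- **PROVED — clause (1) read "open in the product topology on `Datum`" is CLOSED BY W1** (every `D ⊇ arithDialSpace`:
a heavy prime dial of `ζ` above the finitely many constrained windows is a member, `≠ ζ`, negative). [folklore] -/
theorem not_separates_of_isOpen_arith {S D : Set Datum} (hD : arithDialSpace ⊆ D) (hS : IsOpen S) :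
    ¬ Separates S D zetaDatum := by
  rintro ⟨hζ, hneg⟩
  obtain ⟨S', hS'S, hζ', hfd⟩ := exists_finitelyDetermined_of_isOpen hS hζ
  obtain ⟨A, hA⟩ := hfd.exists_determinedOn_below
  obtain ⟨d, hdD, -, hdS', hd⟩ := determinedOn_below_meets_arithDialNegativesNe hA hζ'
  exact hneg d (hD hdD) hd (hS'S hdS')

open Classical in
/-- **PROVED — window-wise open is NOT Tychonoff-open:** `P⁺` (GapClassG1 §5) is not product-open. [folklore] -/
theorem strictPositiveClass_not_isOpen : ¬ IsOpen strictPositiveClass := by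
  intro hS
  obtain ⟨I, u, hu, hIS⟩ := isOpen_pi_iff.1 hS oneDatum oneDatum_mem_strictPositiveClass
  set w₀ : Window := windowAbove (∑ win ∈ I, win.a) with hw₀
  have hwin₀ : w₀ ∉ I := fun h =>
    windowAbove_not_mem_below _ (Finset.single_le_sum (f := fun w : Window => w.a) (fun w _ => w.ha.le) h)
  have hmem : Function.update oneDatum w₀ (-(1 : Matrix (Fin (w₀.N + 1)) (Fin (w₀.N + 1)) ℝ))
      ∈ (I : Set Window).pi u := fun win hwin => by
    rw [Function.update_of_ne (ne_of_mem_of_not_mem (Finset.mem_coe.1 hwin) hwin₀)]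
    exact (hu win (Finset.mem_coe.1 hwin)).2
  have key := hIS hmem w₀ (fun _ => 1) (fun h => one_ne_zero (congr_fun h 0))
  rw [Function.update_self, Matrix.neg_mulVec, Matrix.one_mulVec, dotProduct_neg] at key
  have : (0 : ℝ) < (fun _ : Fin (w₀.N + 1) => (1 : ℝ)) ⬝ᵥ (fun _ => 1) := by simp [dotProduct]
  linarith

/-! ## §3 The `k`-window COUPLED (sliding) open presentation -/

/-- a `k`-WINDOW JOINT READER: at each anchor `win`, a set of `k`-tuples of blocks (the verdict on the blocks at
`win, win + h, …, win + (k-1)h`, all at truncation `N(win)`; `k = 1`: a single-window reader). [folklore] -/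
abbrev CoupledReader (k : ℕ) (h : ℝ) (hh : 0 ≤ h) : Type :=
  (win : Window) →
    Set ((j : Fin k) → Matrix (Fin ((win.lookAhead h hh j).N + 1)) (Fin ((win.lookAhead h hh j).N + 1)) ℝ)

/-- the TUPLE of blocks of `d` at the `k` look-ahead windows of the anchor `win` (same truncation). [folklore] -/
def tupleAt (k : ℕ) (h : ℝ) (hh : 0 ≤ h) (d : Datum) (win : Window) :
    (j : Fin k) → Matrix (Fin ((win.lookAhead h hh j).N + 1)) (Fin ((win.lookAhead h hh j).N + 1)) ℝ :=
  fun j => d (win.lookAhead h hh j)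

/-- the COUPLED CLASS of a joint reader: the verdict imposed at EVERY anchor (top-free). [folklore] -/
def coupledClass (k : ℕ) (h : ℝ) (hh : 0 ≤ h) (P : CoupledReader k h hh) : Set Datum :=
  {d | ∀ win, tupleAt k h hh d win ∈ P win}

/-- the coupled class with anchors restricted to `T` (served grids: `T` finite or of bounded height). [folklore] -/
def coupledClassOn (T : Set Window) (k : ℕ) (h : ℝ) (hh : 0 ≤ h) (P : CoupledReader k h hh) : Set Datum :=
  {d | ∀ win ∈ T, tupleAt k h hh d win ∈ P win}

/-- **TYPED — clause (1′), the `k`-WINDOW COUPLED (sliding) OPEN PRESENTATION:** `S` is the coupled class of a joint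
reader with OPEN verdict sets (`k = 1`: the product presentation `IsWindowwiseOpen`). A set-level class definition. -/
def IsCoupledOpen (k : ℕ) (h : ℝ) (hh : 0 ≤ h) (S : Set Datum) : Prop :=
  ∃ P : CoupledReader k h hh, (∀ win, IsOpen (P win)) ∧ S = coupledClass k h hh P

/-- the zeroth look-ahead window is the anchor. [folklore] -/
theorem Window.lookAhead_zero (win : Window) (h : ℝ) (hh : 0 ≤ h) : win.lookAhead h hh 0 = win := by
  cases win; simp [Window.lookAhead, Window.stepUp]

/-- **PROVED — every WINDOW-WISE OPEN set is COUPLED-OPEN**, for every `k ≥ 1` and every stride. [folklore] -/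
theorem IsWindowwiseOpen.isCoupledOpen {S : Set Datum} (hS : IsWindowwiseOpen S) {k : ℕ} (hk : 0 < k) (h : ℝ)
    (hh : 0 ≤ h) : IsCoupledOpen k h hh S := by
  obtain ⟨U, hU, rfl⟩ := hS
  refine ⟨fun win => {m | ∀ j : Fin k, m j ∈ U (win.lookAhead h hh j)}, fun win => ?_, ?_⟩
  · dsimp only
    rw [Set.setOf_forall]
    exact isOpen_iInter_of_finite fun j => (hU _).preimage (continuous_apply j)
  · ext d
    simp only [coupledClass, tupleAt, mem_setOf_eq]
    refine ⟨fun hd win j => hd _, fun hd win => ?_⟩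
    have e : win.lookAhead h hh ((⟨0, hk⟩ : Fin k) : ℕ) = win := win.lookAhead_zero h hh
    have := hd win ⟨0, hk⟩
    rw [e] at this
    exact this

/-- **PROVED — a COUPLED-OPEN set `∋ ζ` is STABLE ALONG every window-wise convergent dial** (clause (3) from (1′)):
patch `ζ` at `win` by the dialled block; only the `≤ k` anchors `win − jh` read `win`, each OPENLY. [folklore] -/
theorem IsCoupledOpen.stableAlong {k : ℕ} {h : ℝ} {hh : 0 ≤ h} {S : Set Datum} (hS : IsCoupledOpen k h hh S)
    (hζ : zetaDatum ∈ S) {ι : Type*} {l : Filter ι} {c : ι → Datum}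
    (hc : ∀ win, Tendsto (fun i => c i win) l (𝓝 (zetaDatum win))) : StableAlong S l c := by
  classical
  obtain ⟨P, hP, rfl⟩ := hS
  intro win
  have hφ : ∀ w : Window, Continuous fun M : Matrix (Fin (win.N + 1)) (Fin (win.N + 1)) ℝ =>
      tupleAt k h hh (Function.update zetaDatum win M) w := fun w =>
    continuous_pi fun j => (continuous_apply (w.lookAhead h hh j)).comp (continuous_const.update win continuous_id)
  -- the only anchors whose tuple contains `win`: `anchor j = (win.a − jh, win.N)`, `j < k`
  let anchor : ℕ → Window := fun j => if hj : 0 < win.a - j * h then ⟨win.a - j * h, win.N, hj⟩ else win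
  have hanch : ∀ (w : Window) (j : Fin k), w.lookAhead h hh j = win → w = anchor j := by
    intro w j e
    have ha : (w.lookAhead h hh j).a = win.a := congrArg Window.a e
    have hN : (w.lookAhead h hh j).N = win.N := congrArg Window.N e
    simp only [Window.lookAhead, Window.stepUp] at ha hN
    have hpos : 0 < win.a - (j : ℕ) * h := by linarith [w.ha]
    obtain ⟨a, N, ha'⟩ := w
    simp only [anchor, dif_pos hpos, Window.mk.injEq]
    exact ⟨by simp only at ha; linarith, hN⟩
  have hV : IsOpen (⋂ j : Fin k,
      (fun M => tupleAt k h hh (Function.update zetaDatum win M) (anchor j)) ⁻¹' P (anchor j)) :=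
    isOpen_iInter_of_finite fun j => (hP _).preimage (hφ _)
  have hζV : zetaDatum win ∈ ⋂ j : Fin k,
      (fun M => tupleAt k h hh (Function.update zetaDatum win M) (anchor j)) ⁻¹' P (anchor j) := by
    simp only [mem_iInter, mem_preimage, Function.update_eq_self]
    exact fun j => hζ (anchor j)
  refine ((hc win).eventually_mem (hV.mem_nhds hζV)).mono fun i hi => ?_
  refine ⟨Function.update zetaDatum win (c i win), fun w => ?_, by simp⟩
  by_cases hw : ∃ j : Fin k, w.lookAhead h hh j = win
  · obtain ⟨j, hj⟩ := hw
    have hw' := hanch w j hj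
    subst hw'
    simp only [mem_iInter, mem_preimage] at hi
    exact hi j
  · have : tupleAt k h hh (Function.update zetaDatum win (c i win)) w = tupleAt k h hh zetaDatum w :=
      funext fun j => Function.update_of_ne (fun e => hw ⟨j, e⟩) _ _
    rw [this]
    exact hζ w

/-- **PROVED — clause (3) is discharged by the coupled presentation** (as by the product one). [folklore] -/
theorem IsCoupledOpen.dialStable {k : ℕ} {h : ℝ} {hh : 0 ≤ h} {S : Set Datum} (hS : IsCoupledOpen k h hh S) :
    DialStable S := fun hζ =>
  ⟨fun p _ => hS.stableAlong hζ fun win => (tendsto_pDial p win).mono_left nhdsWithin_le_nhds,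
    hS.stableAlong hζ fun win => (tendsto_shiftDial win).mono_left nhdsWithin_le_nhds⟩

/-- **TYPED — `G1-coupled(k, h)`:** coupled-open ∧ non-local at every height ∧ dial-stable (RH-strength member-wise). -/
def InG1coupled (k : ℕ) (h : ℝ) (hh : 0 ≤ h) (S : Set Datum) : Prop :=
  IsCoupledOpen k h hh S ∧ NonlocalAtEveryHeight S ∧ DialStable S

/-- PROVED — the MEMBERSHIP CERTIFICATE schema: coupled-open presentation + height exits ⇒ `G1-coupled`. [folklore] -/
theorem inG1coupled_of {k : ℕ} {h : ℝ} {hh : 0 ≤ h} {S : Set Datum} (hS : IsCoupledOpen k h hh S)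
    (hnl : NonlocalAtEveryHeight S) : InG1coupled k h hh S :=
  ⟨hS, hnl, hS.dialStable⟩

/-- PROVED — `G1-cont ⊆ G1-coupled(k, h)` for every `k ≥ 1` and every stride. [folklore] -/
theorem InG1cont.inG1coupled {S : Set Datum} (hG : InG1cont S) {k : ℕ} (hk : 0 < k) (h : ℝ) (hh : 0 ≤ h) :
    InG1coupled k h hh S :=
  ⟨hG.1.isCoupledOpen hk h hh, hG.2.1, hG.2.2⟩

/-- PROVED — W1 does not apply to a `G1-coupled` member (clause (2) ⇒ not finitely determined). [folklore] -/
theorem InG1coupled.not_finitelyDetermined {k : ℕ} {h : ℝ} {hh : 0 ≤ h} {S : Set Datum}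
    (hG : InG1coupled k h hh S) : ¬ FinitelyDetermined S :=
  hG.2.1.not_finitelyDetermined

/-! ## §4 Bounded anchor sets are inside W1 — one theorem for all coupled readers -/

/-- PROVED: a coupled class anchored below height `A` is decided below height `A + k·h`. [folklore] -/
theorem determinedOn_coupledClassOn_below {A : ℝ} {T : Set Window} (hT : T ⊆ below A) (k : ℕ) (h : ℝ)
    (hh : 0 ≤ h) (P : CoupledReader k h hh) : DeterminedOn (coupledClassOn T k h hh P) (below (A + k * h)) := by
  intro d d' hdd'
  simp only [coupledClassOn, mem_setOf_eq]
  refine forall₂_congr fun win hwin => ?_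
  have : tupleAt k h hh d win = tupleAt k h hh d' win := funext fun j => hdd' _ (by
    show win.a + (j : ℕ) * h ≤ A + k * h
    have hj : ((j : ℕ) : ℝ) ≤ k := by exact_mod_cast j.is_lt.le
    have ha : win.a ≤ A := hT hwin
    nlinarith)
  rw [this]

/-- **PROVED — W1 for every COUPLED reader on a BOUNDED anchor set** (every `D ⊇ arithDialSpace`); generalises
`not_separates_lookAheadClassOn` / `not_separates_transportTwin_of_subset_below`; served pairs are DATA. [folklore] -/
theorem not_separates_coupledClassOn_below {D : Set Datum} (hD : arithDialSpace ⊆ D) {A : ℝ} {T : Set Window}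
    (hT : T ⊆ below A) (k : ℕ) (h : ℝ) (hh : 0 ≤ h) (P : CoupledReader k h hh) :
    ¬ Separates (coupledClassOn T k h hh P) D zetaDatum :=
  not_separates_of_determinedOn_below_arith hD (determinedOn_coupledClassOn_below hT k h hh P)

/-! ## §5 The strict stride twin: a certified coupled member with no product certificate -/

/-- the STRICT STRIDE LAW as a two-window joint reader: `c·Φ(a)·ε₁(m₀) < Φ(a+h)·ε₁(m₁)`. [folklore] -/
def strideReader (h : ℝ) (hh : 0 ≤ h) (c : ℝ) (Φ : ℝ → ℝ) : CoupledReader 2 h hh := fun win =>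
  {m | c * (Φ win.a * bottomRayleigh (m 0)) < Φ (win.a + h) * bottomRayleigh (m 1)}

/-- **TYPED — THE STRICT STRIDE TWIN** `{d | ∀ (a, N), c·Φ(a)·ε₁(d(a,N)) < Φ(a+h)·ε₁(d(a+h,N))}` (exact stride). -/
def strideTwinStrict (h : ℝ) (hh : 0 ≤ h) (c : ℝ) (Φ : ℝ → ℝ) : Set Datum :=
  coupledClass 2 h hh (strideReader h hh c Φ)

/-- PROVED (unfolding, with the canonical block sizes). [folklore] -/
theorem mem_strideTwinStrict {h : ℝ} {hh : 0 ≤ h} {c : ℝ} {Φ : ℝ → ℝ} {d : Datum} :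
    d ∈ strideTwinStrict h hh c Φ ↔ ∀ win : Window, c * (Φ win.a * bottomRayleigh (d (win.lookAhead h hh 0))) <
      Φ (win.a + h) * bottomRayleigh (d (win.lookAhead h hh 1)) :=
  Iff.rfl

/-- PROVED (§1): the strict stride law is an OPEN joint condition, so the twin is COUPLED-OPEN (`k = 2`). [folklore] -/
theorem isCoupledOpen_strideTwinStrict (h : ℝ) (hh : 0 ≤ h) (c : ℝ) (Φ : ℝ → ℝ) :
    IsCoupledOpen 2 h hh (strideTwinStrict h hh c Φ) :=
  ⟨strideReader h hh c Φ, fun _ =>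
    isOpen_lt (continuous_const.mul (continuous_const.mul ((continuous_bottomRayleigh _).comp (continuous_apply 0))))
      (continuous_const.mul ((continuous_bottomRayleigh _).comp (continuous_apply 1))), rfl⟩

/-- PROVED: positive constant data are members when `c·Φ(a) < Φ(a+h)`. [folklore] -/
theorem scalarDatum_const_mem_strideTwinStrict {h : ℝ} {hh : 0 ≤ h} {c b : ℝ} {Φ : ℝ → ℝ} (hb : 0 < b)
    (hΦ : ∀ a, c * Φ a < Φ (a + h)) : scalarDatum (fun _ => b) ∈ strideTwinStrict h hh c Φ := by
  refine mem_strideTwinStrict.2 fun win => ?_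
  rw [bottomRayleigh_scalarDatum, bottomRayleigh_scalarDatum]
  nlinarith [hΦ win.a]

/-- the patch value used in the exchange / exit arguments: `L = Φ(a+h)/(cΦ(a)) + 1`. [folklore] -/
def bigPatch (h c : ℝ) (Φ : ℝ → ℝ) (a : ℝ) : ℝ := Φ (a + h) / (c * Φ a) + 1

open Classical in
/-- PROVED: patching the member `1` to `L` at the LOWER window of one stride pair exits the twin. [folklore] -/
theorem patch_not_mem_strideTwinStrict {h : ℝ} {hh : 0 ≤ h} (hpos : 0 < h) {c : ℝ} (hc : 0 < c) {Φ : ℝ → ℝ}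
    (hΦpos : ∀ a, 0 < Φ a) (w₁ : Window) :
    Function.update (scalarDatum fun _ => (1 : ℝ)) (w₁.lookAhead h hh 0)
        (scalarDatum (fun _ => bigPatch h c Φ w₁.a) (w₁.lookAhead h hh 0)) ∉ strideTwinStrict h hh c Φ := by
  intro hd
  have key := (mem_strideTwinStrict.1 hd) w₁
  have hne : w₁.lookAhead h hh 1 ≠ w₁.lookAhead h hh 0 := by
    intro e
    have := congrArg Window.a e
    simp only [Window.lookAhead, Window.stepUp, Nat.cast_one, Nat.cast_zero] at this
    linarith
  rw [Function.update_self, Function.update_of_ne hne, bottomRayleigh_scalarDatum, bottomRayleigh_scalarDatum]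
    at key
  have hL : c * (Φ w₁.a * bigPatch h c Φ w₁.a) = Φ (w₁.a + h) + c * Φ w₁.a := by
    have := (hΦpos w₁.a).ne'
    simp only [bigPatch]
    field_simp
  rw [hL, mul_one] at key
  linarith [mul_pos hc (hΦpos w₁.a)]

open Classical in
/-- **PROVED — THE STRICT STRIDE TWIN IS NOT WINDOW-WISE:** the exchange property (`IsWindowwise.mem_of_mix`,
94721571e2b4) fails — members `1` and `L` mixed at one lower window give a non-member. [folklore] -/
theorem not_isWindowwise_strideTwinStrict {h : ℝ} {hh : 0 ≤ h} (hpos : 0 < h) {c : ℝ} (hc : 0 < c) {Φ : ℝ → ℝ}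
    (hΦ : ∀ a, c * Φ a < Φ (a + h)) (hΦpos : ∀ a, 0 < Φ a) : ¬ IsWindowwise (strideTwinStrict h hh c Φ) := by
  intro hW
  let w₁ : Window := ⟨1, 0, one_pos⟩
  have hL : 0 < bigPatch h c Φ w₁.a := by
    have := hΦpos (w₁.a + h); have := mul_pos hc (hΦpos w₁.a); unfold bigPatch; positivity
  exact patch_not_mem_strideTwinStrict hpos hc hΦpos w₁
    (hW.mem_of_mix (scalarDatum_const_mem_strideTwinStrict one_pos hΦ)
      (scalarDatum_const_mem_strideTwinStrict hL hΦ) (w₁.lookAhead h hh 0)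
      (Function.update_self (w₁.lookAhead h hh 0) _ (scalarDatum fun _ => (1 : ℝ)))
      fun w hw => Function.update_of_ne hw _ _)

open Classical in
/-- **PROVED — clause (2) for the strict stride twin:** non-local at every height (patch `1` above `A`). [folklore] -/
theorem nonlocalAtEveryHeight_strideTwinStrict {h : ℝ} {hh : 0 ≤ h} (hpos : 0 < h) {c : ℝ} (hc : 0 < c)
    {Φ : ℝ → ℝ} (hΦ : ∀ a, c * Φ a < Φ (a + h)) (hΦpos : ∀ a, 0 < Φ a) :
    NonlocalAtEveryHeight (strideTwinStrict h hh c Φ) := by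
  intro A
  refine not_determinedOn_of_exit (scalarDatum_const_mem_strideTwinStrict one_pos hΦ)
    (patch_not_mem_strideTwinStrict hpos hc hΦpos (windowAbove A)) (win₀ := (windowAbove A).lookAhead h hh 0)
    (fun hle => ?_) fun w hw => Function.update_of_ne hw _ _
  rw [Window.lookAhead_zero] at hle
  exact windowAbove_not_mem_below A hle

/-- **PROVED — A FULL `G1-coupled(2, h)` CERTIFICATE for the strict stride twin** (membership: DATA/E1). [folklore] -/
theorem inG1coupled_strideTwinStrict {h : ℝ} {hh : 0 ≤ h} (hpos : 0 < h) {c : ℝ} (hc : 0 < c) {Φ : ℝ → ℝ}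
    (hΦ : ∀ a, c * Φ a < Φ (a + h)) (hΦpos : ∀ a, 0 < Φ a) : InG1coupled 2 h hh (strideTwinStrict h hh c Φ) :=
  inG1coupled_of (isCoupledOpen_strideTwinStrict h hh c Φ) (nonlocalAtEveryHeight_strideTwinStrict hpos hc hΦ hΦpos)

/-- **PROVED — PLACEMENT: the coupled stratum is STRICTLY WIDER than the product stratum** (the strict stride twin
is `G1-coupled(2, h)`, not window-wise, so in none of `G1-cont` / `G1-contU` / `G1-int` as typed). [folklore] -/
theorem strideTwinStrict_placement {h : ℝ} {hh : 0 ≤ h} (hpos : 0 < h) {c : ℝ} (hc : 0 < c) {Φ : ℝ → ℝ}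
    (hΦ : ∀ a, c * Φ a < Φ (a + h)) (hΦpos : ∀ a, 0 < Φ a) :
    InG1coupled 2 h hh (strideTwinStrict h hh c Φ) ∧ ¬ IsWindowwise (strideTwinStrict h hh c Φ) ∧
      ¬ InG1cont (strideTwinStrict h hh c Φ) ∧ ¬ InG1contU (strideTwinStrict h hh c Φ) ∧
        ¬ InG1int (strideTwinStrict h hh c Φ) := by
  have hW := not_isWindowwise_strideTwinStrict hpos hc hΦ hΦpos (hh := hh)
  exact ⟨inG1coupled_strideTwinStrict hpos hc hΦ hΦpos, hW, fun hG => hW hG.1.isWindowwise,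
    fun hG => hW hG.1.1.isWindowwise, fun hG => hW hG.1⟩

/-! ## §6 Strength: the exact-stride law is seeded on `(0, h]` by the proved rung (E1, credit nothing) -/

/-- PROVED (CONDITIONAL, E1, no RH claim): `ζ ∈ strideTwinStrict h hh c Φ`, `0 < h < log 3 / 2`, `0 < c`, `Φ > 0` ⇒
every Galerkin bottom of `ζ` is positive (induction on strides, seeded on `(0, h]` by the proved rung). [folklore] -/
theorem bottomRayleigh_pos_of_zeta_mem_strideTwinStrict {h : ℝ} {hh : 0 ≤ h} (hpos : 0 < h)
    (hlog : h < Real.log 3 / 2) {c : ℝ} (hc : 0 < c) {Φ : ℝ → ℝ} (hΦpos : ∀ a, 0 < Φ a)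
    (hζ : zetaDatum ∈ strideTwinStrict h hh c Φ) (win : Window) : 0 < bottomRayleigh (zetaDatum win) := by
  have seed : ∀ w : Window, w.a < Real.log 3 / 2 → 0 < bottomRayleigh (zetaDatum w) := fun w hw =>
    ((weilGroundEnergy_pos_of_lt_log_three_half' w.ha hw).trans_le
      (weilGroundEnergy_le_weilEvenGroundEnergy _)).trans_le (weilEvenGroundEnergy_le_bottomRayleigh' w)
  have hlaw := mem_strideTwinStrict.1 hζ
  -- induction on the number of strides: positivity below height `n·h + h`
  have step : ∀ n : ℕ, ∀ w : Window, w.a ≤ n * h + h → 0 < bottomRayleigh (zetaDatum w) := by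
    intro n
    induction n with
    | zero => intro w hw; exact seed w (by simp only [Nat.cast_zero, zero_mul, zero_add] at hw; linarith)
    | succ n ih =>
      intro w hw
      by_cases hle : w.a ≤ n * h + h
      · exact ih w hle
      · have hlow : 0 < w.a - h := by nlinarith [not_le.1 hle, n.cast_nonneg (α := ℝ)]
        let w' : Window := ⟨w.a - h, w.N, hlow⟩
        have e : w'.lookAhead h hh 1 = w := by
          obtain ⟨a, N, ha⟩ := w; simp [w', Window.lookAhead, Window.stepUp]
        have h01 := hlaw w'
        rw [e] at h01
        have h0 : 0 < bottomRayleigh (zetaDatum (w'.lookAhead h hh 0)) := ih _ (by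
          show w.a - h + (0 : ℕ) * h ≤ n * h + h
          push_cast at hw ⊢; linarith)
        exact (mul_pos_iff_of_pos_left (hΦpos _)).1 ((mul_pos hc (mul_pos (hΦpos _) h0)).trans h01)
  refine step ⌈win.a / h⌉₊ win ?_
  have h1 : win.a / h ≤ ⌈win.a / h⌉₊ := Nat.le_ceil _
  have h2 : win.a = win.a / h * h := by field_simp
  nlinarith [win.ha]

/-- **PROVED (CONDITIONAL, E1; no RH claim) — `ζ ∈ strideTwinStrict h hh c Φ ⇒ RH`** for any stride
`0 < h < log 3 / 2`, `c > 0`, `Φ > 0`: the certified coupled member of §5 is RH-strength member-wise (A104 / A130 A2);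
nobody has the membership. [folklore] -/
theorem riemannHypothesis_of_zeta_mem_strideTwinStrict {h : ℝ} {hh : 0 ≤ h} (hpos : 0 < h)
    (hlog : h < Real.log 3 / 2) {c : ℝ} (hc : 0 < c) {Φ : ℝ → ℝ} (hΦpos : ∀ a, 0 < Φ a)
    (hζ : zetaDatum ∈ strideTwinStrict h hh c Φ) : RiemannHypothesis :=
  riemannHypothesis_of_eventually_nonneg (A := 0) fun win _ =>
    (bottomRayleigh_pos_of_zeta_mem_strideTwinStrict hpos hlog hc hΦpos hζ win).le

end Summit.RiemannHypothesis.RiemannHypothesis.Theorems.PfPersistence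

end
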